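import Summits.HubbardSuperconductivity.HubbardSuperconductivity.Theorems.MesoscopicPairOrder.Negative.StonerBound
import HarnessLib

/-!
# Crux `MesoscopicPairOrder` (stmt-HubbardSuperconductivity-7331), Negative side:
# second moment of the band and the sharpened Stoner spin ceiling `4S ≤ 4n + L² + E₀`

Line `redirect_birth` (lead c9); companion of `StonerBound.lean` (`8S ≤ 4L² + E₀`, kinetic energy of the
polarised sector bounded through the band EDGE `ε ≤ 4`). Here the `↑`-hole part is bounded through the
NEGATIVE PART of the band instead, `Σ_k ε_k x_k ≥ -Σ_k (ε_k)₋ ‖φ‖²`, and `Σ_k (ε_k)₋ ≤ L²` is obtained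
without evaluating `Σ_k |ε_k| ≈ 1.62 L²`: `(ε)₋ ≤ ε²/8 + 1/2 - ε/2` pointwise and `Σ_k ε_k² = 4L²`,
`Σ_k ε_k = 0` (character orthogonality). For `H = hubbardTorus 2 L 1 U`, `U ≥ 0`, `L ≥ 3`:

* `sum_cos_sq_latticeMomentum` (`Σ_k cos²(p_i(k)) = L²/2`), `sum_cos_mul_cos_latticeMomentum` (`= 0`),
  `sum_torusBand_sq` (`Σ_k ε_L(k)² = 4 L²`), `sum_negPart_torusBand_le` (`Σ_k (ε_L(k))₋ ≤ L²`);
* `re_expect_hubbardTorus_zero_ge_negPart` — on Lieb's sector `(a, b)`: `Re⟨φ, H₀φ⟩ ≥ (-L² - 4b)‖φ‖²`;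
* `minEnergyOn_ge_of_polarisedBound` — the ladder transfer once and for all: a kinetic lower bound
  `c₀‖φ‖² ≤ Re⟨φ, H₀φ⟩` on the sector `(n + S, n - S)` gives `c₀ ≤ E₀` as soon as the `(2n, S^z = 0)` sector
  has a ground state of total spin `S`;
* `four_spin_le_of_groundState` — **`4S ≤ 4n + L² + E₀`**; `four_spin_le_of_pairedSea` —
  **`4S ≤ 4n + L² + 2Σ_{k∈l} ε_L(k) + U·n`** for every `n`-momentum paired Fermi sea (so a trial sea with
  `2Σ_l ε ≤ -(1 + Uν + 4κ)L²` forces the deficiency `n - S ≥ κL²`; better than the edge bound when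
  `ν = n/L² < 3/8`, i.e. for `δ > 1/4`).

Sources: E. C. Stoner, Proc. R. Soc. A 165 (1938) 372; E. H. Lieb, PRL 62 (1989) 1201; H. Tasaki,
Prog. Theor. Phys. 99 (1998) 489, §5; E. H. Lieb, M. Loss, *Analysis* (2001) Thm 1.14. Folklore
finite-dimensional statements; no definition, no named fact.
-/

noncomputable section

-- the summit namespace repeats the problem name by design (D-0017)
set_option linter.dupNamespace false

namespace Summit.HubbardSuperconductivity.HubbardSuperconductivity.Theorems.MesoscopicPairOrder.Negative

open Matrix Finset Filter
open Literature.Probability.LatticeModels Literature.MathematicalPhysics.QuantumLattice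
open scoped ComplexOrder ComplexConjugate

section Moments

variable {L : ℕ} [NeZero L]

/-! ### Second moment of the band -/

omit [NeZero L] in
/-- The phase of the character at `2e_i` is twice the `i`-th lattice momentum (`L ≥ 3`, so that
`(2 : ℤ/Lℤ).val = 2`). [folklore] -/
theorem torusPhase_single_two (hL : 3 ≤ L) (q : TorusSite 2 L) (i : Fin 2) :
    torusPhase L q (Pi.single i (((2 : ℕ) : ZMod L))) = 2 * latticeMomentum L q i := by
  unfold torusPhase
  rw [latticeMomentum_apply]
  have hval : ∀ j : Fin 2, (((Pi.single i (((2 : ℕ) : ZMod L)) : TorusSite 2 L) j).val : ℝ) =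
      if j = i then 2 else 0 := by
    intro j
    by_cases hj : j = i
    · subst hj
      rw [Pi.single_eq_same, if_pos rfl, ZMod.val_natCast, Nat.mod_eq_of_lt (by omega)]
      norm_num
    · rw [Pi.single_eq_of_ne hj, ZMod.val_zero, if_neg hj]
      norm_num
  simp_rw [hval, mul_ite, mul_zero]
  rw [Finset.sum_ite_eq' Finset.univ i, if_pos (Finset.mem_univ i)]
  ring

/-- `Σ_k cos(2 p_i(k)) = 0` on the `L × L` torus, `L ≥ 3` (the character at `2e_i ≠ 0`). [folklore] -/
theorem sum_cos_two_mul_latticeMomentum_eq_zero (hL : 3 ≤ L) (i : Fin 2) :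
    ∑ k : TorusSite 2 L, Real.cos (2 * latticeMomentum L k i) = 0 := by
  have hw : (Pi.single i (((2 : ℕ) : ZMod L)) : TorusSite 2 L) ≠ 0 := fun h => by
    have h2 := congrFun h i
    rw [Pi.single_eq_same, Pi.zero_apply] at h2
    have h3 := congrArg ZMod.val h2
    rw [ZMod.val_natCast, Nat.mod_eq_of_lt (by omega), ZMod.val_zero] at h3
    exact absurd h3 (by norm_num)
  have h := congrArg Complex.re (sum_torusChar L (Pi.single i (((2 : ℕ) : ZMod L)) : TorusSite 2 L))
  rw [if_neg hw, Complex.zero_re, Complex.re_sum] at h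
  simp_rw [torusChar_re, torusPhase_single_two hL] at h
  exact h

/-- **`Σ_k cos²(p_i(k)) = L²/2`** (`L ≥ 3`): `cos² = 1/2 + cos(2·)/2`. [folklore] -/
theorem sum_cos_sq_latticeMomentum (hL : 3 ≤ L) (i : Fin 2) :
    ∑ k : TorusSite 2 L, Real.cos (latticeMomentum L k i) ^ 2 = (L : ℝ) ^ 2 / 2 := by
  simp_rw [Real.cos_sq]
  have hcard : Fintype.card (TorusSite 2 L) = L ^ 2 := by
    simp [Fintype.card_pi, ZMod.card]
  have h2 : ∑ x : TorusSite 2 L, Real.cos (2 * latticeMomentum L x i) / 2 = 0 := by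
    rw [← Finset.sum_div, sum_cos_two_mul_latticeMomentum_eq_zero hL i, zero_div]
  rw [Finset.sum_add_distrib, h2, add_zero, Finset.sum_const, Finset.card_univ, hcard]
  simp only [nsmul_eq_mul]
  push_cast
  ring

/-- Sums over the two coordinates of the `L × L` momentum grid factor through `ℤ/Lℤ × ℤ/Lℤ`. [folklore] -/
theorem sum_torusSite_two {β : Type*} [AddCommMonoid β] (f : ZMod L → ZMod L → β) :
    ∑ k : TorusSite 2 L, f (k 0) (k 1) = ∑ a : ZMod L, ∑ b : ZMod L, f a b := by
  rw [← Fintype.sum_prod_type']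
  exact Fintype.sum_equiv (piFinTwoEquiv fun _ => ZMod L) _ _ fun k => rfl

/-- `Σ_{v ∈ ℤ/Lℤ} cos(2πv/L) = 0` (`L ≥ 2`; the one-coordinate form of `sum_cos_latticeMomentum_eq_zero`). [folklore] -/
theorem sum_cos_val_eq_zero (hL : 2 ≤ L) :
    ∑ v : ZMod L, Real.cos (2 * Real.pi * ((v.val : ℝ)) / L) = 0 := by
  have h := sum_cos_latticeMomentum_eq_zero (L := L) hL 0
  have h2 : ∑ k : TorusSite 2 L, Real.cos (latticeMomentum L k 0) =
      ∑ a : ZMod L, ∑ _b : ZMod L, Real.cos (2 * Real.pi * ((a.val : ℝ)) / L) := by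
    simp_rw [latticeMomentum_apply]
    exact sum_torusSite_two (fun a _ => Real.cos (2 * Real.pi * ((a.val : ℝ)) / L))
  rw [h2] at h
  simp only [Finset.sum_const, Finset.card_univ, ZMod.card, nsmul_eq_mul] at h
  rw [← Finset.mul_sum] at h
  have hL0 : (L : ℝ) ≠ 0 := by exact_mod_cast (show L ≠ 0 by omega)
  exact (mul_eq_zero.1 h).resolve_left hL0

/-- **`Σ_k cos(p₀(k)) cos(p₁(k)) = 0`** (`L ≥ 2`): the double sum factors into two vanishing cosine sums. [folklore] -/
theorem sum_cos_mul_cos_latticeMomentum (hL : 2 ≤ L) :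
    ∑ k : TorusSite 2 L, Real.cos (latticeMomentum L k 0) * Real.cos (latticeMomentum L k 1) = 0 := by
  have h2 : ∑ k : TorusSite 2 L, Real.cos (latticeMomentum L k 0) * Real.cos (latticeMomentum L k 1) =
      ∑ a : ZMod L, ∑ b : ZMod L, Real.cos (2 * Real.pi * ((a.val : ℝ)) / L) *
        Real.cos (2 * Real.pi * ((b.val : ℝ)) / L) := by
    simp_rw [latticeMomentum_apply]
    exact sum_torusSite_two (fun a b => Real.cos (2 * Real.pi * ((a.val : ℝ)) / L) *
      Real.cos (2 * Real.pi * ((b.val : ℝ)) / L))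
  rw [h2]
  simp_rw [← Finset.mul_sum, sum_cos_val_eq_zero hL, mul_zero, Finset.sum_const_zero]

/-- **`Σ_k ε_L(k)² = 4 L²`** on the `L × L` torus, `L ≥ 3`: `ε = -2(c₀ + c₁)`, `Σ c_i² = L²/2`,
`Σ c₀c₁ = 0`. (Equivalently `tr T² = 4L²` for the hopping matrix: every site has four neighbours.) [folklore] -/
theorem sum_torusBand_sq (hL : 3 ≤ L) : ∑ k : TorusSite 2 L, torusBand L k ^ 2 = 4 * (L : ℝ) ^ 2 := by
  have e : ∀ k : TorusSite 2 L, torusBand L k ^ 2 =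
      4 * Real.cos (latticeMomentum L k 0) ^ 2 + 4 * Real.cos (latticeMomentum L k 1) ^ 2 +
        8 * (Real.cos (latticeMomentum L k 0) * Real.cos (latticeMomentum L k 1)) := by
    intro k
    unfold torusBand
    rw [Fin.sum_univ_two]
    ring
  simp_rw [e]
  rw [Finset.sum_add_distrib, Finset.sum_add_distrib, ← Finset.mul_sum, ← Finset.mul_sum, ← Finset.mul_sum,
    sum_cos_sq_latticeMomentum hL 0, sum_cos_sq_latticeMomentum hL 1,
    sum_cos_mul_cos_latticeMomentum (by omega)]
  ring

/-- **The negative part of the band has total mass at most `L²`**: `Σ_k max(-ε_L(k), 0) ≤ L²` (`L ≥ 3`),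
from the pointwise `max(-ε, 0) ≤ ε²/8 + 1/2 - ε/2` (i.e. `(ε ± 2)² ≥ 0`) and `Σ ε² = 4L²`, `Σ ε = 0`.
(The true value is `(8/π²) L² + O(L) ≈ 0.81 L²`.) [folklore] -/
theorem sum_negPart_torusBand_le (hL : 3 ≤ L) :
    ∑ k : TorusSite 2 L, max (-torusBand L k) 0 ≤ (L : ℝ) ^ 2 := by
  have hpt : ∀ k : TorusSite 2 L, max (-torusBand L k) 0 ≤
      torusBand L k ^ 2 / 8 + 1 / 2 - torusBand L k / 2 := by
    intro k
    refine max_le ?_ ?_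
    · nlinarith [sq_nonneg (torusBand L k + 2)]
    · nlinarith [sq_nonneg (torusBand L k - 2)]
  have hcard : (Finset.univ : Finset (TorusSite 2 L)).card = L ^ 2 := by
    simp [Finset.card_univ, Fintype.card_pi, ZMod.card]
  calc ∑ k : TorusSite 2 L, max (-torusBand L k) 0
      ≤ ∑ k : TorusSite 2 L, (torusBand L k ^ 2 / 8 + 1 / 2 - torusBand L k / 2) := Finset.sum_le_sum fun k _ => hpt k
    _ = (∑ k : TorusSite 2 L, torusBand L k ^ 2) / 8 + (L : ℝ) ^ 2 / 2 -
          (∑ k : TorusSite 2 L, torusBand L k) / 2 := by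
        rw [Finset.sum_sub_distrib, Finset.sum_add_distrib, Finset.sum_div, Finset.sum_div, Finset.sum_const,
          hcard]
        simp only [nsmul_eq_mul]
        push_cast
        ring
    _ = (L : ℝ) ^ 2 := by
        rw [sum_torusBand_sq hL, sum_torusBand_eq_zero (by omega)]
        ring

/-! ### Kinetic energy on a polarised sector, through the negative part of the band -/

/-- **`Re⟨φ, H₀φ⟩ ≥ (-L² - 4b)‖φ‖²` on Lieb's sector `(a, b)`** (`L ≥ 3`): the `↑` part
`Σ_k ε_k x_k↑ ≥ -Σ_k (ε_k)₋ ‖φ‖² ≥ -L²‖φ‖²` (`0 ≤ x_k ≤ ‖φ‖²`, `sum_negPart_torusBand_le`), the `↓` part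
`≥ -4b‖φ‖²`. Independent of `a`; sharper than the band-edge bound `-4(L² - a) - 4b` when `a < 3L²/4`.
Lieb–Loss (2001) Thm 1.14. [folklore] -/
theorem re_expect_hubbardTorus_zero_ge_negPart (hL : 3 ≤ L) {a b : ℕ}
    {φ : Fock (Orb (FermionTorus 2 L))} (hφ : IsInSector a b φ) :
    (-(L : ℝ) ^ 2 - 4 * b) * (star φ ⬝ᵥ φ).re ≤ (star φ ⬝ᵥ (hubbardTorus 2 L 1 0 *ᵥ φ)).re := by
  rw [hubbardTorus_zero_eq_sum_momentumNumber hL, Matrix.sum_mulVec, dotProduct_sum, Complex.re_sum]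
  have hsplit : ∀ k : TorusSite 2 L,
      (star φ ⬝ᵥ ((∑ σ : Fin 2, ((torusBand L k : ℝ) : ℂ) • momentumNumber k σ) *ᵥ φ)).re =
        torusBand L k * (star φ ⬝ᵥ (momentumNumber k 0 *ᵥ φ)).re +
          torusBand L k * (star φ ⬝ᵥ (momentumNumber k 1 *ᵥ φ)).re := by
    intro k
    rw [Matrix.sum_mulVec, dotProduct_sum, Complex.re_sum, Fin.sum_univ_two]
    simp only [Fin.isValue, Matrix.smul_mulVec, dotProduct_smul, smul_eq_mul, Complex.re_ofReal_mul]
  simp only [hsplit, Finset.sum_add_distrib]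
  have hdown := sum_re_expect_momentumNumber_down hφ
  have hnorm : 0 ≤ (star φ ⬝ᵥ φ).re := (Complex.nonneg_iff.1 (dotProduct_star_self_nonneg φ)).1
  -- `↑`: `ε x ≥ -max(-ε, 0) ‖φ‖²` termwise
  have h1 : -(∑ k : TorusSite 2 L, max (-torusBand L k) 0) * (star φ ⬝ᵥ φ).re ≤
      ∑ k : TorusSite 2 L, torusBand L k * (star φ ⬝ᵥ (momentumNumber k 0 *ᵥ φ)).re := by
    rw [neg_mul, Finset.sum_mul, ← Finset.sum_neg_distrib]
    refine Finset.sum_le_sum fun k _ => ?_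
    have hx := re_expect_momentumNumber_mem_Icc k 0 φ
    by_cases hε : 0 ≤ torusBand L k
    · rw [max_eq_right (by linarith)]
      nlinarith [hx.1]
    · push Not at hε
      rw [max_eq_left (by linarith)]
      nlinarith [hx.2]
  have hneg := sum_negPart_torusBand_le (L := L) hL
  -- `↓`: `Σ ε x ≥ -4 b ‖φ‖²`
  have h2 : -(4 : ℝ) * (b * (star φ ⬝ᵥ φ).re) ≤
      ∑ k : TorusSite 2 L, torusBand L k * (star φ ⬝ᵥ (momentumNumber k 1 *ᵥ φ)).re := by
    rw [← hdown, Finset.mul_sum]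
    refine Finset.sum_le_sum fun k _ => ?_
    have hx := re_expect_momentumNumber_mem_Icc k 1 φ
    have hε := neg_four_le_torusBand L k
    nlinarith [hx.1, hx.2]
  nlinarith [mul_le_mul_of_nonneg_right hneg hnorm]

/-! ### The sharpened spin ceiling -/

omit [NeZero L] in
/-- **Ladder transfer of a polarised kinetic bound.** If every vector `φ` of Lieb's sector `(n + S, n - S)`
has `c₀ ‖φ‖² ≤ Re⟨φ, H₀ φ⟩`, then `c₀ ≤ E₀ = minEnergyOn H (szSector (2n) 0)` for `H = hubbardTorus 2 L 1 U`,
`U ≥ 0`, as soon as that sector has a ground state `ψ` with `S² ψ = S(S+1) ψ` (`S ≤ n`): the top member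
`(S⁺)^S ψ` lies in `(n + S, n - S)`, has Rayleigh quotient `E₀` (`[H, S⁻] = 0`), and the interaction is
nonnegative. Lieb (1989); Tasaki (1998) §5. [folklore] -/
theorem minEnergyOn_ge_of_polarisedBound {U : ℝ} (hU : 0 ≤ U) {n S : ℕ} (hS : S ≤ n) {c₀ : ℝ}
    (hbound : ∀ φ : Fock (Orb (FermionTorus 2 L)), IsInSector (n + S) (n - S) φ →
      c₀ * (star φ ⬝ᵥ φ).re ≤ (star φ ⬝ᵥ (hubbardTorus 2 L 1 0 *ᵥ φ)).re)
    {ψ : Fock (Orb (FermionTorus 2 L))} (hgs : IsGroundStateInSector (hubbardTorus 2 L 1 U) (2 * n) 0 ψ)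
    (hspin : spinSq *ᵥ ψ = (((S : ℝ) * ((S : ℝ) + 1) : ℝ) : ℂ) • ψ) :
    c₀ ≤ (hubbardTorus 2 L 1 U).minEnergyOn (szSector (Λ := FermionTorus 2 L) (2 * n) 0) := by
  obtain ⟨hmem, hne, hHψ⟩ := hgs
  have hsec : IsInSector n n ψ := (mem_szSector_two_mul_zero_iff n ψ).1 hmem
  set H := hubbardTorus 2 L 1 U with hH_def
  set E₀ : ℝ := H.minEnergyOn (szSector (Λ := FermionTorus 2 L) (2 * n) 0) with hE₀
  have htri := LiebTwo.isSu2Triple_spin (Λ := FermionTorus 2 L)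
  have hZ0 : HubbardWave0.spinZ *ᵥ ψ = 0 := by
    rw [LiebThm1.spinZ_mulVec_of_isInSector hsec, sub_self, mul_zero, zero_smul]
  have hC : su2Casimir spinPlus spinMinus HubbardWave0.spinZ *ᵥ ψ = ((S : ℂ) * (S + 1)) • ψ := by
    rw [LiebTwo.su2Casimir_spin_eq_spinSq, hspin]
    push_cast
    rfl
  set φ : Fock (Orb (FermionTorus 2 L)) := spinPlus ^ S *ᵥ ψ with hφ_def
  have hφsec : IsInSector (n + S) (n - S) φ := isInSector_spinPlus_pow_mulVec hsec S hS
  set c : ℝ := ((∏ i ∈ Finset.range S, ((S - i) * (S + i + 1)) : ℕ) : ℝ) with hc_def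
  have hc : 0 < c := by rw [hc_def]; exact_mod_cast ladderProd_pos S
  have hcomm : Commute H Literature.MathematicalPhysics.QuantumLattice.spinMinus :=
    LiebThm1.hamiltonian_commute_spinMinus (fermionTorusGraph 2 L) 1 U
  have hHφ : (star φ ⬝ᵥ (H *ᵥ φ)).re = c * (star ψ ⬝ᵥ (H *ᵥ ψ)).re :=
    su2_re_form_P_pow_eq htri H hcomm hZ0 S hC
  have hnφ : (star φ ⬝ᵥ φ).re = c * (star ψ ⬝ᵥ ψ).re := su2_re_normSq_P_pow_eq htri hZ0 S hC
  have hEψ : (star ψ ⬝ᵥ (H *ᵥ ψ)).re = E₀ * (star ψ ⬝ᵥ ψ).re := by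
    rw [hHψ, dotProduct_smul, smul_eq_mul, Complex.re_ofReal_mul]
  have hnψ : 0 < (star ψ ⬝ᵥ ψ).re := by
    have h := Matrix.dotProduct_star_self_pos_iff.2 hne
    exact (Complex.pos_iff.1 h).1
  have hkin := hbound φ hφsec
  have hint := (re_expect_interaction_torus_mem_Icc φ).1
  have hsplit : (star φ ⬝ᵥ (H *ᵥ φ)).re =
      (star φ ⬝ᵥ (hubbardTorus 2 L 1 0 *ᵥ φ)).re +
        U * (star φ ⬝ᵥ ((∑ x : FermionTorus 2 L, numberOp x 0 * numberOp x 1 :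
          Matrix (Finset (Orb (FermionTorus 2 L))) _ ℂ) *ᵥ φ)).re := by
    rw [hH_def, hubbardTorus_eq_zero_add_smul_interaction U, add_mulVec, Matrix.smul_mulVec, dotProduct_add,
      dotProduct_smul, smul_eq_mul, Complex.add_re, Complex.re_ofReal_mul]
  have hlow : c₀ * (star φ ⬝ᵥ φ).re ≤ (star φ ⬝ᵥ (H *ᵥ φ)).re := by
    rw [hsplit]
    nlinarith [hkin, mul_nonneg hU hint]
  rw [hHφ, hEψ, hnφ] at hlow
  have hpos : 0 < c * (star ψ ⬝ᵥ ψ).re := mul_pos hc hnψ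
  have key : c₀ * (c * (star ψ ⬝ᵥ ψ).re) ≤ E₀ * (c * (star ψ ⬝ᵥ ψ).re) := by
    calc c₀ * (c * (star ψ ⬝ᵥ ψ).re) ≤ c * (E₀ * (star ψ ⬝ᵥ ψ).re) := hlow
      _ = E₀ * (c * (star ψ ⬝ᵥ ψ).re) := by ring
  exact le_of_mul_le_mul_right key hpos

/-- **SHARPENED SPIN CEILING `4S ≤ 4n + L² + E₀`** (`U ≥ 0`, `L ≥ 3`, ground state of the `(2n, S^z = 0)`
sector with `S² = S(S+1)`, `S ≤ n`): `minEnergyOn_ge_of_polarisedBound` with the negative-part kinetic bound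
`(-L² - 4(n - S))‖φ‖² ≤ Re⟨φ, H₀φ⟩` on `(n + S, n - S)`. [folklore] -/
theorem four_spin_le_of_groundState (hL : 3 ≤ L) {U : ℝ} (hU : 0 ≤ U) {n S : ℕ} (hS : S ≤ n)
    {ψ : Fock (Orb (FermionTorus 2 L))} (hgs : IsGroundStateInSector (hubbardTorus 2 L 1 U) (2 * n) 0 ψ)
    (hspin : spinSq *ᵥ ψ = (((S : ℝ) * ((S : ℝ) + 1) : ℝ) : ℂ) • ψ) :
    4 * (S : ℝ) ≤ 4 * n + (L : ℝ) ^ 2 +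
      (hubbardTorus 2 L 1 U).minEnergyOn (szSector (Λ := FermionTorus 2 L) (2 * n) 0) := by
  have h := minEnergyOn_ge_of_polarisedBound (L := L) hU hS (c₀ := -(L : ℝ) ^ 2 - 4 * ((n - S : ℕ) : ℝ))
    (fun φ hφ => re_expect_hubbardTorus_zero_ge_negPart hL hφ) hgs hspin
  rw [Nat.cast_sub hS] at h
  linarith

/-- **`4S ≤ 4n + L² + 2Σ_{k∈l} ε_L(k) + U·n`** for every duplicate-free list `l` of `n` momenta (paired Fermi
sea `Φ_l` as trial vector: unit, in the sector, kinetic energy `2Σ_l ε`, at most `n` doublons). A trial sea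
with `2Σ_l ε ≤ -(1 + Uν + 4κ)L²` (`ν = n/L²`) forces the deficiency `n - S ≥ κL²` of every ground multiplet.
Stoner (1938); Tasaki (1998) §5. [folklore] -/
theorem four_spin_le_of_pairedSea (hL : 3 ≤ L) {U : ℝ} (hU : 0 ≤ U) {n S : ℕ} (hS : S ≤ n)
    {ψ : Fock (Orb (FermionTorus 2 L))} (hgs : IsGroundStateInSector (hubbardTorus 2 L 1 U) (2 * n) 0 ψ)
    (hspin : spinSq *ᵥ ψ = (((S : ℝ) * ((S : ℝ) + 1) : ℝ) : ℂ) • ψ)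
    {l : List (TorusSite 2 L)} (hl : l.Nodup) (hlen : l.length = n) :
    4 * (S : ℝ) ≤ 4 * n + (L : ℝ) ^ 2 + 2 * ∑ k ∈ l.toFinset, torusBand L k + U * n := by
  have h := four_spin_le_of_groundState hL hU hS hgs hspin
  set Φ : Fock (Orb (FermionTorus 2 L)) :=
    (List.prod (List.map (fun k : TorusSite 2 L => (pairMode k)ᴴ) l)) *ᵥ
      (vacuum : Fock (Orb (FermionTorus 2 L))) with hΦ_def
  have hΦmem : Φ ∈ szSector (Λ := FermionTorus 2 L) (2 * n) 0 := by
    have h := pairedState_mem_szSector (L := L) l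
    rwa [hlen] at h
  have hΦ1 : star Φ ⬝ᵥ Φ = 1 := star_pairedState_dotProduct_self hl
  have hH : (hubbardTorus 2 L 1 U).IsHermitian := LiebThm1.hamiltonian_isHermitian _ 1 U
  have hvar := minEnergyOn_le_rayleigh_of_mem hH _ hΦmem hΦ1
  have hkin : (star Φ ⬝ᵥ (hubbardTorus 2 L 1 0 *ᵥ Φ)).re = 2 * ∑ k ∈ l.toFinset, torusBand L k :=
    re_expect_hubbardTorus_zero_pairedState hL hl
  have hsec : IsInSector n n Φ := (mem_szSector_two_mul_zero_iff n Φ).1 hΦmem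
  have hint := re_expect_interaction_le_down hsec
  rw [hΦ1, Complex.one_re, mul_one] at hint
  have hsplit : (star Φ ⬝ᵥ (hubbardTorus 2 L 1 U *ᵥ Φ)).re =
      (star Φ ⬝ᵥ (hubbardTorus 2 L 1 0 *ᵥ Φ)).re +
        U * (star Φ ⬝ᵥ ((∑ x : FermionTorus 2 L, numberOp x 0 * numberOp x 1 :
          Matrix (Finset (Orb (FermionTorus 2 L))) _ ℂ) *ᵥ Φ)).re := by
    rw [hubbardTorus_eq_zero_add_smul_interaction U, add_mulVec, Matrix.smul_mulVec, dotProduct_add,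
      dotProduct_smul, smul_eq_mul, Complex.add_re, Complex.re_ofReal_mul]
  rw [hsplit, hkin] at hvar
  nlinarith [mul_le_mul_of_nonneg_left hint hU]

/-- Registered sub-goal form (line `redirect_birth`, lead c9): the sharpened Stoner criterion with the paired
Fermi sea as trial vector, all parameters explicit (`four_spin_le_of_pairedSea`). [folklore] -/
theorem fourSpinLeOfPairedSea : ∀ {L : ℕ} [NeZero L], 3 ≤ L → ∀ {U : ℝ}, 0 ≤ U → ∀ {n S : ℕ}, S ≤ n → ∀ {ψ : Fock (Orb (FermionTorus 2 L))}, IsGroundStateInSector (hubbardTorus 2 L 1 U) (2 * n) 0 ψ → spinSq *ᵥ ψ = (((S : ℝ) * ((S : ℝ) + 1) : ℝ) : ℂ) • ψ → ∀ {l : List (TorusSite 2 L)}, l.Nodup → l.length = n → 4 * (S : ℝ) ≤ 4 * n + (L : ℝ) ^ 2 + 2 * ∑ k ∈ l.toFinset, torusBand L k + U * n :=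
  fun hL _ hU _ _ hS _ hgs hspin _ hl hlen => four_spin_le_of_pairedSea hL hU hS hgs hspin hl hlen

end Moments

end Summit.HubbardSuperconductivity.HubbardSuperconductivity.Theorems.MesoscopicPairOrder.Negative
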